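import Mathlib
import HarnessLib
import Summits.MatrixMultiplication.MatrixMultiplication.Theorems.FarEdgeDescentDialDegeneration

/-!
# Far-edge descent, kernel XLIV — the floor staircase: resolution law of the dial certificates

Lens «structural dichotomy (special vs generic)», MODEL level (the floor-constrained dial of
kernel XL-D; nothing here enters the route's cut `closes`; rung currency 0).

Kernel XLIII (`FarEdgeDescentDialDegeneration`) typed the degeneration AT the tight endpoint
`β = 2`: the narrowness floor `Vfloor a 2 z m` is `0`, and with a non-positive floor the region
criterion of the cap argument FAILS at Schönhage's order `κ_S` for every `1 ≤ β < 2`.  This file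
types HOW the generic regime `β < 2` approaches that endpoint: through a STAIRCASE.

* `tauP_eq_one_iff` — the floor weight `τ'_j(a, β) = min(1, β/(2 − a^{−j}))` saturates (`= 1`)
  exactly when `β ≥ 2 − a^{−j}`: the stair thresholds `β_j = 2 − a^{−j}` accumulate at `2`.
* `Vfloor_eq_zero_of_ge` — once `β ≥ 2 − a^{−(m+2)}` EVERY weight the depth-`m` truncation sees is
  saturated and `Vfloor a β z m = 0` identically (this generalises XLIII's `Vfloor_two_eq_zero`);
  `Vfloor_pos_of_lt` — conversely, for `β < 2 − a^{−(m+2)}`, `0 < z < 1`, the floor is positive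
  (`≥ (1 − τ'_{m+2}) z^m`); together `Vfloor_pos_iff`.
* `not_regionCriterion_of_ge` / `lt_stair_of_regionCriterion` — THE RESOLUTION LAW: a depth-`m`
  certificate (the region criterion at `κ_S` with a floor level `≤ Vfloor a β z m`, the shape of
  every certified dial in the tree: Cert85/74/19/3920/199 and the slab files, all with `m = 12`) can
  exist at a dial `1 ≤ β < 2` ONLY IF `β < 2 − a^{−(m+2)}`, i.e. the truncation depth must exceed
  `log_a (1/(2 − β)) − 2`; `no_depth12_certificate_near_two` is the `a = 2, m = 12` instance: on
  `[2 − 2^{−14}, 2)` no depth-12 certificate exists for any `(z, ε)`.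

Reading for the lens: the cost-free endpoint `β = 2` is not a regular boundary point of the strict
regime but an ACCUMULATION POINT of regime changes — on each stair `[2 − a^{−j}, 2 − a^{−(j+1)})`
the floor is affine in `β` (the slab certificates are natural per stair), there are infinitely many
stairs, and a certificate family reaching every `β < 2` must let the depth `m → ∞` (and, by the
first-order budget at the deep fixed point recorded in memo NODE-g63 §3, presumably the scale
`z → 1`) as `β → 2`.  A β-uniform treatment of `(199/100, 2)` is therefore a renormalisation across
stairs, not one more slab — recorded as the lens's next structural target, not attempted here.

HONEST FRAMING: elementary real-inequality facts about the tree's `tauP` / `Vfloor` /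
`RegionCriterion`; no `sorry`, no new definitions, no axioms; nothing about tensors or `ω`.
References: kernels XL-D (`FarEdgeDescentFloorDial`), XLI/XLII (`FarEdgeDescentNarrownessPotential`,
`FarEdgeDescentFloorNarrowness`), XLIII (`FarEdgeDescentDialDegeneration`); Schönhage 1981
[Schonhage1981]; Strassen 1987 [Strassen1987].
-/

noncomputable section

set_option linter.dupNamespace false

namespace Summit.MatrixMultiplication.MatrixMultiplication.Theorems.FarEdgeDescentDialStaircase

open Finset
open Summit.MatrixMultiplication.MatrixMultiplication.Theorems.FarEdgeDescentNarrownessPotential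
open Summit.MatrixMultiplication.MatrixMultiplication.Theorems.FarEdgeDescentFloorNarrowness
open Summit.MatrixMultiplication.MatrixMultiplication.Theorems.FarEdgeDescentDialDegeneration

/-! ## The stairs: when a floor weight saturates -/

/-- The floor denominators are positive for `a ≥ 1`. -/
theorem floorDen_pos {a : ℝ} (ha : 1 ≤ a) (j : ℕ) : 0 < 2 - a⁻¹ ^ j := by
  have ha0 : 0 < a := by linarith
  have hi0 : 0 ≤ a⁻¹ := inv_nonneg.mpr ha0.le
  have hi1 : a⁻¹ ≤ 1 := inv_le_one_of_one_le₀ ha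
  have hp1 : a⁻¹ ^ j ≤ 1 := pow_le_one₀ hi0 hi1
  linarith

/-- Above the stair threshold `β_j = 2 − a^{−j}` the weight is saturated: `τ'_j = 1`. -/
theorem tauP_eq_one_of_ge {a β : ℝ} (ha : 1 ≤ a) {j : ℕ} (h : 2 - a⁻¹ ^ j ≤ β) :
    tauP a β j = 1 := by
  have hD := floorDen_pos ha j
  unfold tauP
  apply min_eq_left
  rw [le_div_iff₀ hD]
  linarith

/-- Below the stair threshold the weight is the affine function `β/(2 − a^{−j})` of `β`. -/
theorem tauP_eq_div_of_le {a β : ℝ} (ha : 1 ≤ a) {j : ℕ} (h : β ≤ 2 - a⁻¹ ^ j) :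
    tauP a β j = β / (2 - a⁻¹ ^ j) := by
  have hD := floorDen_pos ha j
  unfold tauP
  apply min_eq_right
  rw [div_le_iff₀ hD]
  linarith

/-- Strictly below the threshold the weight is NOT saturated. -/
theorem tauP_lt_one_of_lt {a β : ℝ} (ha : 1 ≤ a) {j : ℕ} (h : β < 2 - a⁻¹ ^ j) :
    tauP a β j < 1 := by
  have hD := floorDen_pos ha j
  rw [tauP_eq_div_of_le ha h.le, div_lt_one hD]
  exact h

/-- **The stairs.** `τ'_j(a, β) = 1 ↔ 2 − a^{−j} ≤ β` (`a ≥ 1`). -/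
theorem tauP_eq_one_iff {a β : ℝ} (ha : 1 ≤ a) (j : ℕ) : tauP a β j = 1 ↔ 2 - a⁻¹ ^ j ≤ β := by
  constructor
  · intro h
    by_contra hlt
    exact absurd h (tauP_lt_one_of_lt ha (not_le.mp hlt)).ne
  · exact tauP_eq_one_of_ge ha

/-- The thresholds are monotone in the depth: `2 − a^{−j} ≤ 2 − a^{−(j+1)}`… stated as the useful
consequence: saturation at depth `n` implies saturation at every smaller depth `j ≤ n` (`a ≥ 1`). -/
theorem tauP_eq_one_of_le_depth {a β : ℝ} (ha : 1 ≤ a) {j n : ℕ} (hjn : j ≤ n)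
    (h : 2 - a⁻¹ ^ n ≤ β) : tauP a β j = 1 := by
  have ha0 : 0 < a := by linarith
  have hi0 : 0 ≤ a⁻¹ := inv_nonneg.mpr ha0.le
  have hi1 : a⁻¹ ≤ 1 := inv_le_one_of_one_le₀ ha
  have hmono : a⁻¹ ^ n ≤ a⁻¹ ^ j := pow_le_pow_of_le_one hi0 hi1 hjn
  exact tauP_eq_one_of_ge ha (by linarith)

/-! ## The floor vanishes identically on the top stair of its depth -/

/-- **Saturated truncation.** If `β ≥ 2 − a^{−(m+2)}` then every weight of the depth-`m` truncation
is `1` and the floor is `0`: `Vfloor a β z m = 0` (any `z`).  XLIII's `Vfloor_two_eq_zero` is the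
case `β = 2`. -/
theorem Vfloor_eq_zero_of_ge {a β : ℝ} (ha : 1 ≤ a) (z : ℝ) {m : ℕ} (h : 2 - a⁻¹ ^ (m + 2) ≤ β) :
    Vfloor a β z m = 0 := by
  unfold Vfloor
  have hS : ∑ k ∈ range m, tauP a β (k + 2) * z ^ k = ∑ k ∈ range m, z ^ k := by
    apply sum_congr rfl
    intro k hk
    rw [tauP_eq_one_of_le_depth ha (by have := mem_range.mp hk; omega) h, one_mul]
  rw [hS, tauP_eq_one_of_le_depth ha le_rfl h, one_mul]
  have hg := geom_sum_mul_neg z m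
  nlinarith [hg]

/-- **Unsaturated truncation.** If `β < 2 − a^{−(m+2)}` (`0 < z ≤ 1`, `a ≥ 1`; any real `β`) the floor
is positive: it is at least the unsaturated top term `(1 − τ'_{m+2})·z^m > 0`. -/
theorem Vfloor_pos_of_lt {a β z : ℝ} (ha : 1 ≤ a) (hz0 : 0 < z) (hz1 : z ≤ 1)
    {m : ℕ} (h : β < 2 - a⁻¹ ^ (m + 2)) : 0 < Vfloor a β z m := by
  unfold Vfloor
  have hτ1 : ∀ j : ℕ, tauP a β j ≤ 1 := fun j => min_le_left _ _
  have hS : (1 - z) * ∑ k ∈ range m, tauP a β (k + 2) * z ^ k ≤ (1 - z) * ∑ k ∈ range m, z ^ k := by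
    apply mul_le_mul_of_nonneg_left _ (by linarith)
    apply sum_le_sum
    intro k _
    have := mul_le_mul_of_nonneg_right (hτ1 (k + 2)) (pow_nonneg hz0.le k)
    simpa using this
  have hlt : tauP a β (m + 2) < 1 := tauP_lt_one_of_lt ha h
  have hzm : 0 < z ^ m := pow_pos hz0 m
  have hT : tauP a β (m + 2) * z ^ m < z ^ m := by
    have := mul_lt_mul_of_pos_right hlt hzm
    simpa using this
  have hg := geom_sum_mul_neg z m
  have hE : (1 - z) * ∑ k ∈ range m, z ^ k = 1 - z ^ m := by rw [← hg]; ring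
  linarith [hS, hT, hE]

/-- **The floor is positive exactly below the top stair of its depth** (`0 < z ≤ 1`, `a ≥ 1`):
`0 < Vfloor a β z m ↔ β < 2 − a^{−(m+2)}`. -/
theorem Vfloor_pos_iff {a β z : ℝ} (ha : 1 ≤ a) (hz0 : 0 < z) (hz1 : z ≤ 1)
    (m : ℕ) : 0 < Vfloor a β z m ↔ β < 2 - a⁻¹ ^ (m + 2) := by
  constructor
  · intro hpos
    by_contra hge
    have := Vfloor_eq_zero_of_ge ha z (not_lt.mp hge)
    linarith
  · exact Vfloor_pos_of_lt ha hz0 hz1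

/-! ## The resolution law -/

/-- **No certificate on the top stair.** For `1 ≤ β < 2` with `β ≥ 2 − a^{−(m+2)}` (`a ≥ 1`),
`−1 < ε`, and ANY floor level `Vmin ≤ Vfloor a β z m` (the shape of every certified dial), the
region criterion at Schönhage's order FAILS. -/
theorem not_regionCriterion_of_ge {a β z ε Vmin : ℝ} (ha : 1 ≤ a) (hβ1 : 1 ≤ β) (hβ2 : β < 2)
    (hε : -1 < ε) {m : ℕ} (hst : 2 - a⁻¹ ^ (m + 2) ≤ β) (hV : Vmin ≤ Vfloor a β z m) :
    ¬ RegionCriterion β z ε Vmin (Real.log (4 / 3) / Real.log 2) := by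
  have h0 : Vfloor a β z m = 0 := Vfloor_eq_zero_of_ge ha z hst
  exact not_regionCriterion_kappaS_of_floor_nonpos hβ1 hβ2 hε (by linarith)

/-- **THE RESOLUTION LAW.** If a depth-`m` certificate exists at the dial `β` — the region criterion
at `κ_S` with a floor level `Vmin ≤ Vfloor a β z m`, `1 ≤ β < 2`, `−1 < ε`, `a ≥ 1` — then `β` lies
strictly below the top stair: `β < 2 − a^{−(m+2)}`, i.e. `a^{−(m+2)} < 2 − β`: the truncation depth
must satisfy `m + 2 > log_a (1/(2 − β))`. -/
theorem lt_stair_of_regionCriterion {a β z ε Vmin : ℝ} (ha : 1 ≤ a) (hβ1 : 1 ≤ β) (hβ2 : β < 2)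
    (hε : -1 < ε) {m : ℕ} (hV : Vmin ≤ Vfloor a β z m)
    (h : RegionCriterion β z ε Vmin (Real.log (4 / 3) / Real.log 2)) :
    β < 2 - a⁻¹ ^ (m + 2) := by
  by_contra hge
  exact not_regionCriterion_of_ge ha hβ1 hβ2 hε (not_lt.mp hge) hV h

/-- The same law read as a lower bound on the depth: `a^{−(m+2)} < 2 − β`. -/
theorem inv_pow_lt_gap_of_regionCriterion {a β z ε Vmin : ℝ} (ha : 1 ≤ a) (hβ1 : 1 ≤ β)
    (hβ2 : β < 2) (hε : -1 < ε) {m : ℕ} (hV : Vmin ≤ Vfloor a β z m)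
    (h : RegionCriterion β z ε Vmin (Real.log (4 / 3) / Real.log 2)) :
    a⁻¹ ^ (m + 2) < 2 - β := by
  have := lt_stair_of_regionCriterion ha hβ1 hβ2 hε hV h
  linarith

/-! ## The instance of the certified dials: `a = 2`, depth `m = 12` -/

/-- The top stair of depth `12` at arity `2` starts at `2 − 2^{−14} = 32767/16384`. -/
theorem stair_two_twelve : (2 : ℝ) - (2 : ℝ)⁻¹ ^ (12 + 2) = 32767 / 16384 := by norm_num

/-- **On `[2 − 2^{−14}, 2)` the depth-12 floor of the certified dials is identically zero.** -/
theorem Vfloor_two_twelve_eq_zero {β : ℝ} (h : 32767 / 16384 ≤ β) (z : ℝ) :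
    Vfloor 2 β z 12 = 0 :=
  Vfloor_eq_zero_of_ge (a := 2) (by norm_num) z (m := 12) (by rw [stair_two_twelve]; exact h)

/-- **No depth-12 certificate near the tight endpoint.** For `32767/16384 ≤ β < 2`, any `z`, any
`ε > −1` and any floor level `Vmin ≤ Vfloor 2 β z 12` — the exact shape of the tree's certificates
(`capXLD_of_regionCriterion_le`, `capXLD_allA_of_criterion`, the slab forms) — the region criterion
at `κ_S` fails: the interval `(199/100, 2)` cannot be finished at depth `12`. -/
theorem no_depth12_certificate_near_two {β z ε Vmin : ℝ} (hβ1 : 32767 / 16384 ≤ β) (hβ2 : β < 2)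
    (hε : -1 < ε) (hV : Vmin ≤ Vfloor 2 β z 12) :
    ¬ RegionCriterion β z ε Vmin (Real.log (4 / 3) / Real.log 2) :=
  not_regionCriterion_of_ge (a := 2) (by norm_num) (by linarith) hβ2 hε (m := 12)
    (by rw [stair_two_twelve]; exact hβ1) hV

/-- Conversely the five certified point dials and the certified slabs all sit below that stair:
`199/100 < 32767/16384` (so their positive floor levels are consistent with the law). -/
theorem certifiedDials_below_stair : (199 / 100 : ℝ) < 32767 / 16384 := by norm_num

end Summit.MatrixMultiplication.MatrixMultiplication.Theorems.FarEdgeDescentDialStaircase
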